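import Summits.ResolutionOfSingularities.ResolutionOfSingularities.Theorems.RadicialJungCleanModelsStubRegularTypeDescends
import Summits.ResolutionOfSingularities.ResolutionOfSingularities.Theorems.RadicialJungCleanModelsStubToroidalUnitDescends
import Summits.ResolutionOfSingularities.ResolutionOfSingularities.Theorems.RadicialJungCleanModelsStubFormalOfLooseClean
import HarnessLib

/-!
# Route `RadicialJung`, crux `CleanModels`: Zariski loose cleanness = formal cleanness with algebraic boundary

Route `ResolutionOfSingularities/RadicialJung`, crux item `CleanModels`
(stmt-ResolutionOfSingularities-15917), line `Sketch` rev 6 (lead c1, 2026-08-17).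

The crux asks for a proper birational REGULAR model `V → W` of a degree-`p` radicial extension
`L = K(W)(g₀^{1/p})` on which, at every point `v`, some representative of the `K(W)^p`-line of `g₀`
is LOG-CLEAN in `O = O_{V,v}`: toroidal `u ∏_{i<m} t_i^{a_i}` (`(t_i)` a minimal generating system
of `𝔪_v`, `u ∈ O^×`, `m ≥ 1`, `p ∤ a_i`) or of regular type ((i) a unit residually not a `p`-th
power, (ii) `c^p +` a regular parameter). The printed theorems (Giraud 1983 in dimension 2, Cossart
1987 in dimension 3 over `k̄`) reach such forms in the COMPLETION `Ô = Ô_{V,v}`. This file records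
the exact interface, assembled from the three landed descent/ascent stubs of the line:

* `looseClean_iff_algebraizedFormalClean` — at a regular local ring of prime characteristic `p`,
  Zariski loose cleanness of `x` is EQUIVALENT to formal cleanness WITH ALGEBRAIC BOUNDARY
  (`ι s = û ∏ ι(t_i)^{a_i}` with only the unit `û ∈ Ô^×` formal, or formal regular type (i)/(ii));
* `formalClean_of_looseClean` — and implies plain formal cleanness (formal minimal generating
  system `(τ_i)` of `𝔪̂ = 𝔪 Ô`).

So what separates the printed normal forms from the crux is exactly the ALGEBRAIZATION OF THE
FORMAL BOUNDARY `τ_i = 0` (the line's open stub `stub_algebraizeFormalBoundary`), nothing about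
units or regular types.
-/

noncomputable section

set_option linter.dupNamespace false -- mandated namespace of this single-conjunct summit

open IsLocalRing

namespace Summit.ResolutionOfSingularities.ResolutionOfSingularities.Theorems.RadicialJung.CleanModels

universe u

/-- **At a regular local ring `O` of prime characteristic `p`, an element `x` of an `O`-algebra `K`
is (Zariski) loosely clean iff it is formally clean with ALGEBRAIC boundary**: `x = u ∏ t_i^{a_i}`
(`u ∈ O^×`, `(t_i)` a minimal generating system of `𝔪`, `m ≥ 1`, `p ∤ a_i`), or a unit residually not
a `p`-th power, or `c^p +` a regular parameter — iff — `x = s` with `ι s = û ∏ ι(t_i)^{a_i}` for a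
FORMAL unit `û ∈ Ô^×` (`Ô = AdicCompletion 𝔪 O`), or `ι s - ĉ^p ∉ 𝔪̂` for all `ĉ ∈ Ô`, or
`ι s - ĉ^p ∈ 𝔪̂ ∖ 𝔪̂²` for some `ĉ ∈ Ô`. (`⇒`: `stub_formalOfLooseClean`; `⇐`: the formal unit is
algebraic by faithful flatness, `stub_toroidalUnitDescends`, and formal regular types descend,
`stub_regularTypeDescends`.) This is the exact interface between the two open cores and the crux. -/
theorem looseClean_iff_algebraizedFormalClean {O K : Type u} [CommRing O] [IsRegularLocalRing O]
    [CommRing K] [Algebra O K] (p : ℕ) (hp : p.Prime) [CharP O p] (x : K) :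
    ((∃ (d m : ℕ) (hmd : m ≤ d) (t : Fin d → O) (a : Fin m → ℕ) (u : O), IsUnit u ∧
          Ideal.span (Set.range t) = maximalIdeal O ∧
          ringKrullDim O = (d : WithBot ℕ∞) ∧ 0 < m ∧ (∀ i, ¬ p ∣ a i) ∧
          x = algebraMap O K (u * ∏ i : Fin m, t (Fin.castLE hmd i) ^ (a i))) ∨
        (∃ u : O, IsUnit u ∧ x = algebraMap O K u ∧ ∀ c : O, u - c ^ p ∉ maximalIdeal O) ∨
        (∃ s c : O, x = algebraMap O K s ∧ s - c ^ p ∈ maximalIdeal O ∧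
          s - c ^ p ∉ maximalIdeal O ^ 2)) ↔
      ((∃ (d m : ℕ) (hmd : m ≤ d) (t : Fin d → O) (a : Fin m → ℕ)
          (û : AdicCompletion (maximalIdeal O) O) (s : O), IsUnit û ∧
          Ideal.span (Set.range t) = maximalIdeal O ∧
          ringKrullDim O = (d : WithBot ℕ∞) ∧ 0 < m ∧ (∀ i, ¬ p ∣ a i) ∧
          x = algebraMap O K s ∧
          algebraMap O (AdicCompletion (maximalIdeal O) O) s =
            û * ∏ i : Fin m, algebraMap O (AdicCompletion (maximalIdeal O) O)
              (t (Fin.castLE hmd i)) ^ (a i)) ∨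
        (∃ u : O, IsUnit u ∧ x = algebraMap O K u ∧
          ∀ ĉ : AdicCompletion (maximalIdeal O) O,
            algebraMap O (AdicCompletion (maximalIdeal O) O) u - ĉ ^ p ∉
              (maximalIdeal O).map (algebraMap O (AdicCompletion (maximalIdeal O) O))) ∨
        (∃ (s : O) (ĉ : AdicCompletion (maximalIdeal O) O), x = algebraMap O K s ∧
          algebraMap O (AdicCompletion (maximalIdeal O) O) s - ĉ ^ p ∈
            (maximalIdeal O).map (algebraMap O (AdicCompletion (maximalIdeal O) O)) ∧
          algebraMap O (AdicCompletion (maximalIdeal O) O) s - ĉ ^ p ∉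
            (maximalIdeal O).map (algebraMap O (AdicCompletion (maximalIdeal O) O)) ^ 2)) := by
  refine ⟨(stub_formalOfLooseClean p hp x).1, fun h => ?_⟩
  rcases h with ⟨d, m, hmd, t, a, û, s, hû, ht, hd, hm, ha, hs, hι⟩ | ⟨u, hu, hs, hwound⟩ |
    ⟨s, ĉ, hs, hĉ₁, hĉ₂⟩
  · -- toroidal: the formal unit is algebraic
    obtain ⟨u, hu, hsu⟩ := stub_toroidalUnitDescends hmd t ht hd a s û hû hι
    refine Or.inl ⟨d, m, hmd, t, a, u, hu, ht, hd, hm, ha, ?_⟩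
    rw [hs, hsu]
  · -- formal type (i)
    exact Or.inr (Or.inl ⟨u, hu, hs, (stub_regularTypeDescends (O := O) p hp).1 u hwound⟩)
  · -- formal type (ii)
    obtain ⟨c, hc₁, hc₂⟩ := (stub_regularTypeDescends (O := O) p hp).2 s ⟨ĉ, hĉ₁, hĉ₂⟩
    exact Or.inr (Or.inr ⟨s, c, hs, hc₁, hc₂⟩)

/-- **Zariski loose cleanness is formally clean**: at a regular local ring `O` of prime
characteristic `p`, a loosely clean `x` is formally loosely clean — `ι s = û ∏ τ_i^{a_i}` for a
minimal generating system `(τ_i)` of `𝔪̂ = 𝔪 Ô` and `û ∈ Ô^×`, or of formal regular type (i)/(ii)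
(both conjuncts of `stub_formalOfLooseClean`). In particular the line's first open core,
"formally clean principalization", is a consequence of the crux. -/
theorem formalClean_of_looseClean {O K : Type u} [CommRing O] [IsRegularLocalRing O]
    [CommRing K] [Algebra O K] (p : ℕ) (hp : p.Prime) [CharP O p] (x : K)
    (h : (∃ (d m : ℕ) (hmd : m ≤ d) (t : Fin d → O) (a : Fin m → ℕ) (u : O), IsUnit u ∧
          Ideal.span (Set.range t) = maximalIdeal O ∧
          ringKrullDim O = (d : WithBot ℕ∞) ∧ 0 < m ∧ (∀ i, ¬ p ∣ a i) ∧
          x = algebraMap O K (u * ∏ i : Fin m, t (Fin.castLE hmd i) ^ (a i))) ∨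
        (∃ u : O, IsUnit u ∧ x = algebraMap O K u ∧ ∀ c : O, u - c ^ p ∉ maximalIdeal O) ∨
        (∃ s c : O, x = algebraMap O K s ∧ s - c ^ p ∈ maximalIdeal O ∧
          s - c ^ p ∉ maximalIdeal O ^ 2)) :
    (∃ (d m : ℕ) (hmd : m ≤ d) (τ : Fin d → AdicCompletion (maximalIdeal O) O) (a : Fin m → ℕ)
        (û : AdicCompletion (maximalIdeal O) O) (s : O), IsUnit û ∧
        Ideal.span (Set.range τ) =
          (maximalIdeal O).map (algebraMap O (AdicCompletion (maximalIdeal O) O)) ∧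
        ringKrullDim O = (d : WithBot ℕ∞) ∧ 0 < m ∧ (∀ i, ¬ p ∣ a i) ∧
        x = algebraMap O K s ∧
        algebraMap O (AdicCompletion (maximalIdeal O) O) s =
          û * ∏ i : Fin m, τ (Fin.castLE hmd i) ^ (a i)) ∨
      (∃ u : O, IsUnit u ∧ x = algebraMap O K u ∧
        ∀ ĉ : AdicCompletion (maximalIdeal O) O,
          algebraMap O (AdicCompletion (maximalIdeal O) O) u - ĉ ^ p ∉
            (maximalIdeal O).map (algebraMap O (AdicCompletion (maximalIdeal O) O))) ∨
      (∃ (s : O) (ĉ : AdicCompletion (maximalIdeal O) O), x = algebraMap O K s ∧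
        algebraMap O (AdicCompletion (maximalIdeal O) O) s - ĉ ^ p ∈
          (maximalIdeal O).map (algebraMap O (AdicCompletion (maximalIdeal O) O)) ∧
        algebraMap O (AdicCompletion (maximalIdeal O) O) s - ĉ ^ p ∉
          (maximalIdeal O).map (algebraMap O (AdicCompletion (maximalIdeal O) O)) ^ 2) :=
  (stub_formalOfLooseClean p hp x).2 ((stub_formalOfLooseClean p hp x).1 h)

end Summit.ResolutionOfSingularities.ResolutionOfSingularities.Theorems.RadicialJung.CleanModels

end
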